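/-
Copyright: statement-level skeleton of a published paper (lit-balaban cell, Phase-2 proof seat p13, gen 4; v1.1 = §7
appended by the same seat). No proof claims beyond what the kernel checks below.
-/
import Mathlib

/-!
# `Balaban1983to89.B4Sect5Fourier519` — T. Bałaban, *Regularity and decay of lattice Green's functions*, Commun.
Math. Phys. **89** (1983) 571–597 [Balaban1983RegularityDecay] (= B4), Sect. 5, pp. 595–596 [PDF 25–26]:
**display (5.19)** — the Fourier transform of `g₁(j) = e^{−δ₂|j|}` on `Z` (line 1 of p. 596), the Fourier-integral
representation of the `n`-fold convolution `g_n = g₁ * … * g₁`, its evenness `g_n(j) = g_n(|j|)` — **and (5.20)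
`|g_n(j)| ≤ c₂ⁿe^{−½δ₂|j|}` DERIVED FROM (5.19)** as printed (*"and from this we obtain"*: contour shift to
`Im p = ½δ₂`), with `c₂` explicit; v1.1 (§7): the sentence of p. 595 *"the sum over j's [in (5.18)] factorizes into
sums over components … can be written as Π_{μ=1}^{d} g_{2n}(j_μ − j′_μ), g_{2n} = g₁ * … * g₁"*

statement-level skeleton of published theorems with citation tags; proofs where landed; nothing here is a claim
about the Yang–Mills mass gap

PDF held: `paper:balaban1983-cmp89-regularity-decay` (journal page = PDF page + 570); page renders
`run/shared/lean/pub/pub-balaban/b2b-balaban-ref1/pages/1983-cmp89-regularity-decay/…-p025/026-x2.png` (read for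
this file; the displays below are transcribed from the render of p. 596, not from the OCR text layer).

CITATION HEADER (lean-in-tree rule).  Part of the lit-balaban TYPED SKELETON (HOME `run/shared/lean/pub/lit-balaban/`):
WHAT IS REPRODUCED = row **B4.Eq5.15** of `HOME/lit-balaban-r01/ROWS-B4.md` (v1.13), member **(5.19)** — the row's
one display listed *"NOT reproduced as displays: (5.19) (Fourier representation of (5.18)'s convolution — replaced
by the elementary bound)"* after `B4Sect5WalkDecay` (p247099: (5.18)/(5.20)/(5.21) ⇒ (5.7)), `B4Sect5WalkPerturb`
(p247894: (5.24)–(5.27) ⇒ (5.10)) and `B4Sect5WalkDelta` (p248107: (5.22)–(5.23) ⇒ (5.8)) — together with the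
printed derivation **(5.19) ⇒ (5.20)**.  Unit `lit-balaban-p13` (gen 4); owner r01; referee ref-4.  The file is
SELF-CONTAINED (imports Mathlib only): (5.19)–(5.20) are statements about explicit functions on `Z`; nothing landed
is edited or restated.  INTERFACES §3 row F-T4-410 (the NE spine cites B4 (5.19)–(5.24)).

THE PRINTED TEXT (verbatim, p. 595 bottom – p. 596 top [PDF 25–26]).  *"To investigate the sums above, it is
convenient to take the absolute value |j| defined by |j| = Σ_{μ=1}^{d} |j_μ|; then the sum over j's factorizes into
sums over components. If we define g₁(j) = e^{−δ₂|j|}, j ∈ Z, then the sum over j's in (5.18) can be written as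
Π_{μ=1}^{d} g_{2n}(j_μ − j′_μ), g_{2n} = g₁ * … * g₁ is a convolution of 2n functions g₁. The Fourier transform of
g₁ is equal to
  Σ_{j∈Z} e^{−ipj}e^{−δ₂|j|} = (1 − e^{−ip−δ₂})^{−1} + (1 − e^{ip−δ₂})^{−1} − 1
                             = (1 − e^{−2δ₂}) / ((1 − e^{−ip−δ₂})(1 − e^{ip−δ₂})),
so we have
  g_n(j) = (1/2π) ∫_{−π}^{π} dp e^{ijp} (1 − e^{−2δ₂})ⁿ / ((1 − e^{−ip}e^{−δ₂})ⁿ(1 − e^{ip}e^{−δ₂})ⁿ),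
  g_n(j) = g_n(|j|),                                                                            (5.19)
and from this we obtain
  |g_n(j)| ≤ c₂ⁿ e^{−½δ₂|j|}, for some c₂.                                                      (5.20)"*

THE TYPING (what is proved, and not more).
* OBJECTS (§1, definitions with bodies): `g1 δ₂ j = e^{−δ₂|j|}` on `Z`; the convolution on `Z`,
  `zconv f g j = Σ'_{k∈Z} f(k)g(j−k)` (unconditional sum); `gn δ₂ n = g₁ * … * g₁` (`n` factors, `gn δ₂ 0 = δ₀` the
  unit, `gn_one : gn δ₂ 1 = g₁`); the symbol `symb δ₂ p = (1 − e^{−2δ₂})/((1 − e^{−ip}e^{−δ₂})(1 − e^{ip}e^{−δ₂}))`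
  at COMPLEX `p` (the base of the integrand of (5.19)); the constant `c2 δ₂ = (1 − e^{−2δ₂})/((1 − e^{−δ₂/2})
  (1 − e^{−3δ₂/2}))` making the print's *"for some c₂"* explicit.  Hypothesis throughout: `δ₂ > 0` (in B4,
  `δ₂ = ¼δ₀`).
* LINE 1 of p. 596 (the Fourier transform of `g₁`): `hasSum_fourier_g1` — the FIRST equality as a `HasSum` over
  `Z` (the two geometric series `j ≥ 0`, `j ≤ −1`: Mathlib `hasSum_geometric_of_norm_lt_one` +
  `HasSum.of_nat_of_neg_add_one`); `geom_identity` — the SECOND equality (algebra, `e^{−ip−δ₂}e^{ip−δ₂} = e^{−2δ₂}`);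
  `hasSum_fourier_g1_symb` — hence `Σ_j e^{−ipj}g₁(j) = symb(p)`.
* (5.19): `eq519` — `g_n(j) = (1/2π)∫_{−π}^{π} e^{ijp} symb(p)ⁿ dp` for ALL `n ≥ 0`, `j ∈ Z` (as an identity in `ℂ`,
  the left side real), and `eq519_printed` with the integrand written exactly as printed; proved by induction on
  `n` — orthogonality `∫_{−π}^{π} e^{imp}dp = 2π[m = 0]` (`integral_cexp_I_mul`, the case `n = 0`), and the step
  `g₁ * g_n ↦ symb · symbⁿ` by termwise integration (Mathlib's dominated-convergence
  `intervalIntegral.hasSum_integral_of_dominated_convergence`, dominated by `g₁(k)·sup|symb|ⁿ/2π`) using line 1.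
  Second clause `eq519_abs : g_n(j) = g_n(|j|)` (induction: the convolution of even functions is even,
  `zconv_neg_of_even`).
* (5.20) FROM (5.19): the print says only *"from this we obtain"*; the derivation typed is the standard one the
  formula (5.19) affords — the integrand `e^{ijp}symb(p)ⁿ` is `2π`-periodic (`integrand_add_two_pi`) and analytic in
  the strip `|Im p| < δ₂` (`symb_den_ne_zero`), so by Cauchy's theorem on the rectangle `[−π, π] × [0, a]`
  (Mathlib's `Complex.integral_boundary_rect_eq_zero_of_differentiableOn`; the vertical sides cancel by
  periodicity) the integral may be taken over `Im p = a`, `0 ≤ a < δ₂` (`integral_shift`); on `Im p = ½δ₂`,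
  `|e^{ijp}| = e^{−½δ₂j}` (`j ≥ 0`; `j < 0` by evenness) and `|symb| ≤ c₂` (`norm_symb_shift_le`, from
  `|1 − u| ≥ 1 − |u|`), whence **`ineq520`**: `|g_n(j)| ≤ c₂ⁿe^{−½δ₂|j|}` for all `n`, `j`, and the verbatim
  existential form `ineq520_printed`.  The choice `Im p = ½δ₂` is what produces the printed rate `½δ₂`; any
  `a < δ₂` would give rate `a` with `c₂(a) = (1 − e^{−2δ₂})/((1 − e^{a−δ₂})(1 − e^{−a−δ₂}))`.
* §7 (v1.1) — THE SENTENCE OF p. 595 *"it is convenient to take the absolute value |j| = Σ_μ|j_μ|; then the sum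
  over j's factorizes into sums over components … the sum over j's in (5.18) can be written as
  Π_{μ=1}^{d} g_{2n}(j_μ − j′_μ), g_{2n} = g₁ * … * g₁"*: `exp_neg_l1_eq_prod` (`e^{−δ₂Σ_μ|x_μ|} = Π_μ g₁(x_μ)`);
  `hasSum_chain` — `g_m = g₁ * … * g₁` UNROLLED in one dimension: for `k` intermediate points the chain sum
  `Σ_{j₁,…,j_k∈Z} g₁(j−j₁)g₁(j₁−j₂)…g₁(j_k−j′)` has sum `g_{k+1}(j − j′)` (`HasSum` over `Z^k`; the chain is the tuple
  `Fin.cons j (Fin.snoc J j′)`; induction on `k`, the step being the convolution `hasSum_gn_succ` summed fiberwise —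
  non-negative terms, Mathlib `summable_prod_of_nonneg`/`HasSum.prod_fiberwise`); `hasSum_pi_prod_of_nonneg` —
  Tonelli on `X^ι` for products of non-negative coordinate factors (*"factorizes into sums over components"*);
  **`hasSum_chain_factorizes`** — for `j, j′ ∈ Z^d` and any number `k + 1 ≥ 1` of steps (the print's `2n`, i.e.
  `k = 2n − 1` intermediate points `j₁, …, j_{2n−1} ∈ Z^d` as in (5.18)) the sum of
  `e^{−δ₂|j−j₁|}…e^{−δ₂|j_k−j′|}` over `(Z^d)^k`, `|x| = Σ_μ|x_μ|`, has sum `Π_μ g_{k+1}(j_μ − j′_μ)` (transpose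
  `(Z^d)^k ≃ (Z^k)^d` by `Equiv.piComm`, then Tonelli and `hasSum_chain` per component).  Also `gn_nonneg`,
  `gn_le` (`0 ≤ g_n ≤ c₂ⁿ`), `c2_pos`.
* NOT HERE: no claim about (5.18), (5.21) or (5.7) themselves is made in this file (`B4Sect5WalkDecay`, p247099, runs
  (5.18)/(5.20)/(5.21) ⇒ (5.7) in the sup-distance of `Z^d` with the elementary form of (5.20); this file supplies
  the printed `ℓ¹`/Fourier ingredients (5.19)–(5.20) and the factorization sentence as stand-alone theorems).
  Standard axioms only.
-/

noncomputable section

open Complex MeasureTheory Set Filter intervalIntegral Real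
open scoped Interval

namespace Literature.MathematicalPhysics.QuantumFieldTheory.Balaban1983to89.B4Sect5Fourier519

variable {δ₂ : ℝ}

/-! ## §1 The objects of the print: `g₁`, the convolution on `Z`, `g_n`, the symbol of (5.19), `c₂` -/

/-- *"If we define g₁(j) = e^{−δ₂|j|}, j ∈ Z"* (p. 595). [cite: Balaban1983RegularityDecay, (5.19) p.595] -/
def g1 (δ₂ : ℝ) (j : ℤ) : ℝ := Real.exp (-(δ₂ * |(j : ℝ)|))

/-- The convolution of two functions on `Z`, `(f * g)(j) = Σ_{k ∈ Z} f(k)g(j − k)` (as an unconditional sum;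
*"g_{2n} = g₁ * … * g₁ is a convolution of 2n functions g₁"*, p. 595). [cite: Balaban1983RegularityDecay, (5.19) p.595] -/
def zconv (f g : ℤ → ℝ) (j : ℤ) : ℝ := ∑' k : ℤ, f k * g (j - k)

/-- `g_n = g₁ * … * g₁`, the `n`-fold convolution power of `g₁` on `Z` (`g₀ = δ₀`, the unit of the convolution,
so that `g₁ = g₁ * g₀`; the print uses `n ≥ 1`). [cite: Balaban1983RegularityDecay, (5.19) p.595–596] -/
def gn (δ₂ : ℝ) : ℕ → ℤ → ℝ
  | 0 => fun j => if j = 0 then 1 else 0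
  | n + 1 => zconv (g1 δ₂) (gn δ₂ n)

/-- The symbol under the integral sign of (5.19) (the Fourier transform of `g₁`), at a complex momentum `p`:
`(1 − e^{−2δ₂}) / ((1 − e^{−ip}e^{−δ₂})(1 − e^{ip}e^{−δ₂}))`. [cite: Balaban1983RegularityDecay, (5.19) p.596] -/
def symb (δ₂ : ℝ) (p : ℂ) : ℂ :=
  (1 - Real.exp (-(2 * δ₂)) : ℂ) /
    ((1 - Complex.exp (-(I * p)) * Real.exp (-δ₂)) * (1 - Complex.exp (I * p) * Real.exp (-δ₂)))

/-- The constant `c₂` of (5.20) *"|g_n(j)| ≤ c₂ⁿe^{−½δ₂|j|}, for some c₂"* made explicit: the supremum bound of the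
symbol of (5.19) on the line `Im p = ½δ₂`, `c₂ = (1 − e^{−2δ₂})/((1 − e^{−δ₂/2})(1 − e^{−3δ₂/2}))`.
[cite: Balaban1983RegularityDecay, (5.20) p.596] -/
def c2 (δ₂ : ℝ) : ℝ := (1 - Real.exp (-(2 * δ₂))) / ((1 - Real.exp (-(δ₂ / 2))) * (1 - Real.exp (-(3 * δ₂ / 2))))

/-! ## §2 Elementary properties of `g₁` and `g_n` -/

/-- [cite: Balaban1983RegularityDecay, (5.19) p.595] -/
@[simp] theorem gn_zero (δ₂ : ℝ) (j : ℤ) : gn δ₂ 0 j = if j = 0 then 1 else 0 := rfl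

/-- [cite: Balaban1983RegularityDecay, (5.19) p.595] -/
theorem gn_succ (δ₂ : ℝ) (n : ℕ) (j : ℤ) : gn δ₂ (n + 1) j = ∑' k : ℤ, g1 δ₂ k * gn δ₂ n (j - k) := rfl

/-- [cite: Balaban1983RegularityDecay, (5.19) p.595] -/
theorem g1_pos (δ₂ : ℝ) (j : ℤ) : 0 < g1 δ₂ j := Real.exp_pos _

/-- [cite: Balaban1983RegularityDecay, (5.19) p.595] -/
theorem g1_nonneg (δ₂ : ℝ) (j : ℤ) : 0 ≤ g1 δ₂ j := (g1_pos δ₂ j).le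

/-- `g₁` is even. [cite: Balaban1983RegularityDecay, (5.19) p.595] -/
theorem g1_neg (δ₂ : ℝ) (j : ℤ) : g1 δ₂ (-j) = g1 δ₂ j := by
  simp [g1]

/-- [cite: Balaban1983RegularityDecay, (5.19) p.595] -/
@[simp] theorem g1_zero (δ₂ : ℝ) : g1 δ₂ 0 = 1 := by simp [g1]

/-- `g₁(n) = (e^{−δ₂})ⁿ` for `n ≥ 0`. [cite: Balaban1983RegularityDecay, (5.19) p.595] -/
theorem g1_natCast (δ₂ : ℝ) (n : ℕ) : g1 δ₂ (n : ℤ) = Real.exp (-δ₂) ^ n := by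
  rw [g1, Int.cast_natCast, Nat.abs_cast, ← Real.exp_nat_mul]
  congr 1; ring

/-- `g₁(−(n+1)) = (e^{−δ₂})ⁿ⁺¹`. [cite: Balaban1983RegularityDecay, (5.19) p.595] -/
theorem g1_neg_natSucc (δ₂ : ℝ) (n : ℕ) : g1 δ₂ (-((n : ℤ) + 1)) = Real.exp (-δ₂) ^ (n + 1) := by
  rw [g1, ← Real.exp_nat_mul]
  congr 1
  have : |(((-((n : ℤ) + 1) : ℤ)) : ℝ)| = (n : ℝ) + 1 := by
    push_cast
    rw [abs_neg]
    exact abs_of_nonneg (by positivity)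
  rw [this]; push_cast; ring

/-- `Σ_{j ∈ Z} e^{−δ₂|j|} < ∞` for `δ₂ > 0`. [cite: Balaban1983RegularityDecay, (5.19) p.595] -/
theorem summable_g1 (hδ : 0 < δ₂) : Summable (g1 δ₂) := by
  have h0 : 0 ≤ Real.exp (-δ₂) := (Real.exp_pos _).le
  have h1 : Real.exp (-δ₂) < 1 := Real.exp_lt_one_iff.mpr (by linarith)
  refine Summable.of_nat_of_neg_add_one ?_ ?_
  · simp_rw [g1_natCast]
    exact summable_geometric_of_lt_one h0 h1
  · simp_rw [g1_neg_natSucc, pow_succ']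
    exact (summable_geometric_of_lt_one h0 h1).mul_left _

/-- `g₁ * g₀ = g₁`. [cite: Balaban1983RegularityDecay, (5.19) p.595] -/
theorem gn_one (δ₂ : ℝ) (j : ℤ) : gn δ₂ 1 j = g1 δ₂ j := by
  rw [gn_succ]
  rw [tsum_eq_single j]
  · simp
  · intro k hk
    have : j - k ≠ 0 := sub_ne_zero.mpr (Ne.symm hk)
    simp [this]

/-- The convolution of two even functions is even. [cite: Balaban1983RegularityDecay, (5.19) p.596] -/
theorem zconv_neg_of_even {f g : ℤ → ℝ} (hf : ∀ k, f (-k) = f k) (hg : ∀ k, g (-k) = g k) (j : ℤ) :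
    zconv f g (-j) = zconv f g j := by
  unfold zconv
  rw [← (Equiv.neg ℤ).tsum_eq]
  refine tsum_congr fun k => ?_
  simp only [Equiv.neg_apply, hf]
  rw [show -j - -k = -(j - k) by ring, hg]

/-- *"g_n(j) = g_n(|j|)"* — evenness of `g_n`. [cite: Balaban1983RegularityDecay, (5.19) p.596] -/
theorem gn_neg (δ₂ : ℝ) (n : ℕ) (j : ℤ) : gn δ₂ n (-j) = gn δ₂ n j := by
  induction n generalizing j with
  | zero => simp [neg_eq_zero]
  | succ n ih => exact zconv_neg_of_even (g1_neg δ₂) ih j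

/-- (5.19), second clause, verbatim: `g_n(j) = g_n(|j|)`. [cite: Balaban1983RegularityDecay, (5.19) p.596] -/
theorem eq519_abs (δ₂ : ℝ) (n : ℕ) (j : ℤ) : gn δ₂ n j = gn δ₂ n |j| := by
  rcases abs_choice j with h | h
  · rw [h]
  · rw [h, gn_neg]

/-! ## §3 The symbol: algebra, norms, continuity, periodicity -/

/-- `‖e^{−ip}‖ = e^{Im p}`. [cite: Balaban1983RegularityDecay, (5.19) p.596] -/
theorem norm_cexp_neg_I_mul (z : ℂ) : ‖Complex.exp (-(I * z))‖ = Real.exp z.im := by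
  rw [Complex.norm_exp]; congr 1; simp

/-- `‖e^{ip}‖ = e^{−Im p}`. [cite: Balaban1983RegularityDecay, (5.19) p.596] -/
theorem norm_cexp_I_mul (z : ℂ) : ‖Complex.exp (I * z)‖ = Real.exp (-z.im) := by
  rw [Complex.norm_exp]; congr 1; simp

/-- `‖e^{−ip}e^{−δ₂}‖ = e^{Im p − δ₂}`. [cite: Balaban1983RegularityDecay, (5.19) p.596] -/
theorem norm_factor_neg (δ₂ : ℝ) (z : ℂ) :
    ‖Complex.exp (-(I * z)) * (Real.exp (-δ₂) : ℂ)‖ = Real.exp (z.im - δ₂) := by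
  rw [norm_mul, norm_cexp_neg_I_mul, Complex.norm_real, Real.norm_of_nonneg (Real.exp_pos _).le,
    ← Real.exp_add]
  rfl

/-- `‖e^{ip}e^{−δ₂}‖ = e^{−Im p − δ₂}`. [cite: Balaban1983RegularityDecay, (5.19) p.596] -/
theorem norm_factor_pos (δ₂ : ℝ) (z : ℂ) :
    ‖Complex.exp (I * z) * (Real.exp (-δ₂) : ℂ)‖ = Real.exp (-z.im - δ₂) := by
  rw [norm_mul, norm_cexp_I_mul, Complex.norm_real, Real.norm_of_nonneg (Real.exp_pos _).le,
    ← Real.exp_add]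
  rfl

/-- In the open strip `|Im p| < δ₂` the denominator of the symbol does not vanish.
[cite: Balaban1983RegularityDecay, (5.19) p.596] -/
theorem symb_den_ne_zero (δ₂ : ℝ) {z : ℂ} (hlo : -δ₂ < z.im) (hhi : z.im < δ₂) :
    (1 - Complex.exp (-(I * z)) * (Real.exp (-δ₂) : ℂ)) * (1 - Complex.exp (I * z) * (Real.exp (-δ₂) : ℂ))
      ≠ 0 := by
  have aux : ∀ u : ℂ, ‖u‖ < 1 → (1 : ℂ) - u ≠ 0 := fun u hu h0 => by
    rw [← (sub_eq_zero.mp h0), norm_one] at hu; exact lt_irrefl _ hu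
  refine mul_ne_zero (aux _ ?_) (aux _ ?_)
  · rw [norm_factor_neg]; exact Real.exp_lt_one_iff.mpr (by linarith)
  · rw [norm_factor_pos]; exact Real.exp_lt_one_iff.mpr (by linarith)

/-- Norm bound of the symbol from bounds `A, B < 1` on its two small factors:
`‖symb‖ ≤ (1 − e^{−2δ₂})/((1 − A)(1 − B))`. [cite: Balaban1983RegularityDecay, (5.19) p.596] -/
theorem norm_symb_le (hδ : 0 < δ₂) (z : ℂ) {A B : ℝ}
    (hA : ‖Complex.exp (-(I * z)) * (Real.exp (-δ₂) : ℂ)‖ ≤ A) (hA1 : A < 1)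
    (hB : ‖Complex.exp (I * z) * (Real.exp (-δ₂) : ℂ)‖ ≤ B) (hB1 : B < 1) :
    ‖symb δ₂ z‖ ≤ (1 - Real.exp (-(2 * δ₂))) / ((1 - A) * (1 - B)) := by
  unfold symb
  rw [norm_div, norm_mul]
  have hnum0 : 0 ≤ 1 - Real.exp (-(2 * δ₂)) := by
    have : Real.exp (-(2 * δ₂)) ≤ 1 := Real.exp_le_one_iff.mpr (by linarith)
    linarith
  have hnum : ‖(1 - Real.exp (-(2 * δ₂)) : ℂ)‖ = 1 - Real.exp (-(2 * δ₂)) := by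
    rw [show (1 - Real.exp (-(2 * δ₂)) : ℂ) = ((1 - Real.exp (-(2 * δ₂)) : ℝ) : ℂ) by push_cast; rfl,
      Complex.norm_real, Real.norm_of_nonneg hnum0]
  have h1 : 1 - A ≤ ‖1 - Complex.exp (-(I * z)) * (Real.exp (-δ₂) : ℂ)‖ := by
    have := norm_sub_norm_le (1 : ℂ) (Complex.exp (-(I * z)) * (Real.exp (-δ₂) : ℂ))
    rw [norm_one] at this; linarith
  have h2 : 1 - B ≤ ‖1 - Complex.exp (I * z) * (Real.exp (-δ₂) : ℂ)‖ := by
    have := norm_sub_norm_le (1 : ℂ) (Complex.exp (I * z) * (Real.exp (-δ₂) : ℂ))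
    rw [norm_one] at this; linarith
  rw [hnum]
  refine div_le_div_of_nonneg_left hnum0 (mul_pos (by linarith) (by linarith)) ?_
  exact mul_le_mul h1 h2 (by linarith) (norm_nonneg _)

/-- On the real line `‖symb(p)‖ ≤ (1 − e^{−2δ₂})/(1 − e^{−δ₂})²` (`= (1 + e^{−δ₂})/(1 − e^{−δ₂}) = symb(0)`).
[cite: Balaban1983RegularityDecay, (5.19) p.596] -/
theorem norm_symb_real_le (hδ : 0 < δ₂) (p : ℝ) :
    ‖symb δ₂ p‖ ≤ (1 - Real.exp (-(2 * δ₂))) / ((1 - Real.exp (-δ₂)) * (1 - Real.exp (-δ₂))) := by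
  have hr : Real.exp (-δ₂) < 1 := Real.exp_lt_one_iff.mpr (by linarith)
  refine norm_symb_le hδ (p : ℂ) (le_of_eq ?_) hr (le_of_eq ?_) hr
  · rw [norm_factor_neg, Complex.ofReal_im]; ring_nf
  · rw [norm_factor_pos, Complex.ofReal_im]; ring_nf

/-- On the line `Im p = ½δ₂`: `‖symb(p)‖ ≤ c₂`. [cite: Balaban1983RegularityDecay, (5.20) p.596] -/
theorem norm_symb_shift_le (hδ : 0 < δ₂) (x : ℝ) : ‖symb δ₂ (x + (δ₂ / 2 : ℝ) * I)‖ ≤ c2 δ₂ := by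
  have him : ((x : ℂ) + (δ₂ / 2 : ℝ) * I).im = δ₂ / 2 := by simp
  refine norm_symb_le hδ _ (le_of_eq ?_) (Real.exp_lt_one_iff.mpr (by linarith : -(δ₂ / 2) < 0))
    (le_of_eq ?_) (Real.exp_lt_one_iff.mpr (by linarith : -(3 * δ₂ / 2) < 0))
  · rw [norm_factor_neg, him]; ring_nf
  · rw [norm_factor_pos, him]; ring_nf

/-- Continuity of the symbol on the real line. [cite: Balaban1983RegularityDecay, (5.19) p.596] -/
theorem continuous_symb_real (hδ : 0 < δ₂) : Continuous fun p : ℝ => symb δ₂ p := by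
  unfold symb
  refine Continuous.div continuous_const (by fun_prop) fun p => ?_
  exact symb_den_ne_zero δ₂ (z := (p : ℂ)) (by simp; exact hδ) (by simp; exact hδ)

/-- `2π`-periodicity of the symbol. [cite: Balaban1983RegularityDecay, (5.19) p.596] -/
theorem symb_add_two_pi (δ₂ : ℝ) (z : ℂ) : symb δ₂ (z + 2 * π) = symb δ₂ z := by
  unfold symb
  have h1 : Complex.exp (-(I * (z + 2 * π))) = Complex.exp (-(I * z)) := by
    rw [show -(I * (z + 2 * π)) = -(I * z) + ((-1 : ℤ) : ℂ) * (2 * π * I) by push_cast; ring,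
      Complex.exp_add, Complex.exp_int_mul_two_pi_mul_I, mul_one]
  have h2 : Complex.exp (I * (z + 2 * π)) = Complex.exp (I * z) := by
    rw [show I * (z + 2 * π) = I * z + ((1 : ℤ) : ℂ) * (2 * π * I) by push_cast; ring,
      Complex.exp_add, Complex.exp_int_mul_two_pi_mul_I, mul_one]
  rw [h1, h2]

/-- The symbol in the form of line 1 of p. 596: `(1 − e^{−2δ₂})/((1 − e^{−ip−δ₂})(1 − e^{ip−δ₂}))`.
[cite: Balaban1983RegularityDecay, (5.19) p.596] -/
theorem symb_eq (δ₂ : ℝ) (p : ℂ) :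
    symb δ₂ p = (1 - Real.exp (-(2 * δ₂)) : ℂ) /
      ((1 - Complex.exp (-(I * p) - δ₂)) * (1 - Complex.exp (I * p - δ₂))) := by
  unfold symb
  have hr : (Real.exp (-δ₂) : ℂ) = Complex.exp (-(δ₂ : ℂ)) := by
    rw [Complex.ofReal_exp]; push_cast; rfl
  rw [hr, ← Complex.exp_add, ← Complex.exp_add]
  rfl

/-! ## §4 Line 1 of p. 596: the Fourier transform of `g₁` -/

/-- **p. 596, line 1, first equality** (two geometric series):
`Σ_{j ∈ Z} e^{−ipj}e^{−δ₂|j|} = (1 − e^{−ip−δ₂})^{−1} + (1 − e^{ip−δ₂})^{−1} − 1`, as an unconditional (`HasSum`) sum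
over `Z`, `δ₂ > 0`, `p` real. [cite: Balaban1983RegularityDecay, (5.19) p.596] -/
theorem hasSum_fourier_g1 (hδ : 0 < δ₂) (p : ℝ) :
    HasSum (fun j : ℤ => Complex.exp (-(I * p * j)) * (g1 δ₂ j : ℂ))
      ((1 - Complex.exp (-(I * p) - δ₂))⁻¹ + (1 - Complex.exp (I * p - δ₂))⁻¹ - 1) := by
  set f : ℤ → ℂ := fun j => Complex.exp (-(I * p * j)) * (g1 δ₂ j : ℂ) with hf
  have hξ : ‖Complex.exp (-(I * p) - δ₂)‖ < 1 := by
    rw [Complex.norm_exp, Real.exp_lt_one_iff]; simp; exact hδ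
  have hη : ‖Complex.exp (I * p - δ₂)‖ < 1 := by
    rw [Complex.norm_exp, Real.exp_lt_one_iff]; simp; exact hδ
  have key1 : ∀ n : ℕ, f n = Complex.exp (-(I * p) - δ₂) ^ n := by
    intro n
    simp only [hf]
    rw [Int.cast_natCast, g1_natCast, Complex.ofReal_pow, Complex.ofReal_exp, ← Complex.exp_nat_mul,
      ← Complex.exp_nat_mul, ← Complex.exp_add]
    congr 1; push_cast; ring
  have key2 : ∀ n : ℕ, f (-(n + 1)) = Complex.exp (I * p - δ₂) * Complex.exp (I * p - δ₂) ^ n := by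
    intro n
    simp only [hf]
    rw [← pow_succ', g1_neg_natSucc, Complex.ofReal_pow, Complex.ofReal_exp, ← Complex.exp_nat_mul,
      ← Complex.exp_nat_mul, ← Complex.exp_add]
    congr 1; push_cast; ring
  have h1 : HasSum (fun n : ℕ => f n) (1 - Complex.exp (-(I * p) - δ₂))⁻¹ := by
    simp_rw [key1]; exact hasSum_geometric_of_norm_lt_one hξ
  have h2 : HasSum (fun n : ℕ => f (-(n + 1)))
      (Complex.exp (I * p - δ₂) * (1 - Complex.exp (I * p - δ₂))⁻¹) := by
    simp_rw [key2]; exact (hasSum_geometric_of_norm_lt_one hη).mul_left _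
  have h12 := h1.of_nat_of_neg_add_one h2
  have hne : (1 : ℂ) - Complex.exp (I * p - δ₂) ≠ 0 := fun h0 => by
    rw [← (sub_eq_zero.mp h0), norm_one] at hη; exact lt_irrefl _ hη
  have hval : (1 - Complex.exp (-(I * p) - δ₂))⁻¹ + (1 - Complex.exp (I * p - δ₂))⁻¹ - 1 =
      (1 - Complex.exp (-(I * p) - δ₂))⁻¹ +
        Complex.exp (I * p - δ₂) * (1 - Complex.exp (I * p - δ₂))⁻¹ := by
    have : (1 - Complex.exp (I * ↑p - ↑δ₂))⁻¹ - 1 =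
        Complex.exp (I * p - δ₂) * (1 - Complex.exp (I * p - δ₂))⁻¹ := by
      field_simp
      ring
    rw [← this]; ring
  rw [hval]; exact h12

/-- **p. 596, line 1, second equality** (algebra: the product of the two ratios is `e^{−2δ₂}`):
`(1 − e^{−ip−δ₂})^{−1} + (1 − e^{ip−δ₂})^{−1} − 1 = (1 − e^{−2δ₂})/((1 − e^{−ip−δ₂})(1 − e^{ip−δ₂}))`, for every complex
`p` off the zeros of the denominators. [cite: Balaban1983RegularityDecay, (5.19) p.596] -/
theorem geom_identity (δ₂ : ℝ) (p : ℂ) (h1 : (1 : ℂ) - Complex.exp (-(I * p) - δ₂) ≠ 0)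
    (h2 : (1 : ℂ) - Complex.exp (I * p - δ₂) ≠ 0) :
    (1 - Complex.exp (-(I * p) - δ₂))⁻¹ + (1 - Complex.exp (I * p - δ₂))⁻¹ - 1 =
      (1 - Real.exp (-(2 * δ₂)) : ℂ) / ((1 - Complex.exp (-(I * p) - δ₂)) * (1 - Complex.exp (I * p - δ₂))) := by
  have hprod : Complex.exp (-(I * p) - δ₂) * Complex.exp (I * p - δ₂) = (Real.exp (-(2 * δ₂)) : ℂ) := by
    rw [← Complex.exp_add, Complex.ofReal_exp]; congr 1; push_cast; ring
  rw [← hprod]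
  field_simp
  ring

/-- **The Fourier transform of `g₁` is the symbol of (5.19)**: `Σ_{j∈Z} e^{−ipj}g₁(j) = symb(p)` (`HasSum`), `p`
real, `δ₂ > 0`. [cite: Balaban1983RegularityDecay, (5.19) p.596] -/
theorem hasSum_fourier_g1_symb (hδ : 0 < δ₂) (p : ℝ) :
    HasSum (fun j : ℤ => Complex.exp (-(I * p * j)) * (g1 δ₂ j : ℂ)) (symb δ₂ p) := by
  have hξ : ‖Complex.exp (-(I * p) - δ₂)‖ < 1 := by
    rw [Complex.norm_exp, Real.exp_lt_one_iff]; simp; exact hδ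
  have hη : ‖Complex.exp (I * p - δ₂)‖ < 1 := by
    rw [Complex.norm_exp, Real.exp_lt_one_iff]; simp; exact hδ
  have aux : ∀ u : ℂ, ‖u‖ < 1 → (1 : ℂ) - u ≠ 0 := fun u hu h0 => by
    rw [← (sub_eq_zero.mp h0), norm_one] at hu; exact lt_irrefl _ hu
  rw [symb_eq, ← geom_identity δ₂ p (aux _ hξ) (aux _ hη)]
  exact hasSum_fourier_g1 hδ p

/-! ## §5 Display (5.19): the Fourier-integral representation of `g_n` -/

/-- Orthogonality of the characters on `[−π, π]`: `∫_{−π}^{π} e^{imp} dp = 2π·[m = 0]`, `m ∈ Z`.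
[cite: Balaban1983RegularityDecay, (5.19) p.596] -/
theorem integral_cexp_I_mul (m : ℤ) :
    ∫ p in (-π)..π, Complex.exp (I * m * p) = if m = 0 then (2 * π : ℂ) else 0 := by
  split_ifs with hm
  · subst hm
    simp [two_mul]
  · have hc : (I * m : ℂ) ≠ 0 := mul_ne_zero I_ne_zero (by exact_mod_cast hm)
    rw [integral_exp_mul_complex hc]
    have : Complex.exp (I * m * ((π : ℝ) : ℂ)) = Complex.exp (I * m * ((-π : ℝ) : ℂ)) := by
      rw [show I * m * ((π : ℝ) : ℂ) = I * m * ((-π : ℝ) : ℂ) + (m : ℂ) * (2 * π * I) by push_cast; ring,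
        Complex.exp_add, Complex.exp_int_mul_two_pi_mul_I, mul_one]
    rw [this, sub_self, zero_div]

/-- `‖e^{imp}‖ = 1` for real `p`, integer `m`. [cite: Balaban1983RegularityDecay, (5.19) p.596] -/
theorem norm_cexp_I_intCast_mul (m : ℤ) (p : ℝ) : ‖Complex.exp (I * m * p)‖ = 1 := by
  rw [Complex.norm_exp]; simp

/-- `‖1/(2π)‖ = 1/(2π)`. [cite: Balaban1983RegularityDecay, (5.19) p.596] -/
theorem norm_one_div_two_pi : ‖(1 / (2 * π) : ℂ)‖ = 1 / (2 * π) := by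
  rw [show (1 / (2 * π) : ℂ) = ((1 / (2 * π) : ℝ) : ℂ) by push_cast; rfl, Complex.norm_real,
    Real.norm_of_nonneg (by positivity)]

/-- **Display (5.19), first clause** (p. 596): for `δ₂ > 0`, every `n ≥ 0` and `j ∈ Z`,
`g_n(j) = (1/2π) ∫_{−π}^{π} dp e^{ijp} (1 − e^{−2δ₂})ⁿ/((1 − e^{−ip}e^{−δ₂})ⁿ(1 − e^{ip}e^{−δ₂})ⁿ)`, where
`g_n = g₁ * … * g₁` is the `n`-fold convolution on `Z` (DEFINED as the convolution, `gn`; the integrand is `symbⁿ`).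
Proof as printed: the Fourier transform of `g₁` is the symbol (line 1 of p. 596), the transform of a convolution is
the product (termwise integration, dominated convergence), and Fourier inversion on `[−π, π]` (orthogonality);
organised as an induction on `n`. [cite: Balaban1983RegularityDecay, (5.19) p.596] -/
theorem eq519 (hδ : 0 < δ₂) (n : ℕ) (j : ℤ) :
    ((gn δ₂ n j : ℝ) : ℂ) = 1 / (2 * π) * ∫ p in (-π)..π, Complex.exp (I * j * p) * symb δ₂ p ^ n := by
  induction n generalizing j with
  | zero =>
    simp only [gn_zero, pow_zero, mul_one, integral_cexp_I_mul]
    split_ifs with hj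
    · push_cast
      field_simp
    · simp
  | succ n ih =>
    have hS := summable_g1 hδ
    have hsc := continuous_symb_real hδ
    -- the termwise integrands `g₁(k) · (1/2π) e^{i(j−k)p} symb(p)ⁿ`
    set F : ℤ → ℝ → ℂ := fun k p =>
      (g1 δ₂ k : ℂ) * (1 / (2 * π) * (Complex.exp (I * ((j - k : ℤ) : ℂ) * p) * symb δ₂ p ^ n)) with hF
    have hFint : ∀ k, ∫ p in (-π)..π, F k p =
        (g1 δ₂ k : ℂ) * (1 / (2 * π) *
          ∫ p in (-π)..π, Complex.exp (I * ((j - k : ℤ) : ℂ) * p) * symb δ₂ p ^ n) := by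
      intro k
      simp only [hF]
      rw [intervalIntegral.integral_const_mul, intervalIntegral.integral_const_mul]
    have hDCT : HasSum (fun k => ∫ p in (-π)..π, F k p)
        (∫ p in (-π)..π, 1 / (2 * π) * (Complex.exp (I * j * p) * symb δ₂ p ^ (n + 1))) := by
      refine intervalIntegral.hasSum_integral_of_dominated_convergence
        (fun k _ => g1 δ₂ k * (1 / (2 * π) *
          ((1 - Real.exp (-(2 * δ₂))) / ((1 - Real.exp (-δ₂)) * (1 - Real.exp (-δ₂)))) ^ n)) ?_ ?_ ?_ ?_ ?_
      · intro k
        have : Continuous (F k) := by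
          simp only [hF]
          exact continuous_const.mul (continuous_const.mul
            ((Complex.continuous_exp.comp (by fun_prop)).mul (hsc.pow n)))
        exact this.aestronglyMeasurable
      · intro k
        refine Eventually.of_forall fun p _ => ?_
        simp only [hF]
        rw [norm_mul, norm_mul, norm_mul, norm_pow, Complex.norm_real, Real.norm_of_nonneg (g1_nonneg δ₂ k),
          norm_one_div_two_pi, norm_cexp_I_intCast_mul, one_mul]
        refine mul_le_mul_of_nonneg_left ?_ (g1_nonneg δ₂ k)
        refine mul_le_mul_of_nonneg_left ?_ (by positivity)
        exact pow_le_pow_left₀ (norm_nonneg _) (norm_symb_real_le hδ p) n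
      · exact Eventually.of_forall fun p _ => hS.mul_right _
      · exact intervalIntegrable_const
      · refine Eventually.of_forall fun p _ => ?_
        have h := (hasSum_fourier_g1_symb hδ p).mul_right
          (1 / (2 * π) * (Complex.exp (I * j * p) * symb δ₂ p ^ n))
        have hfun : (fun k => F k p) = fun k : ℤ =>
            Complex.exp (-(I * p * k)) * (g1 δ₂ k : ℂ) *
              (1 / (2 * π) * (Complex.exp (I * j * p) * symb δ₂ p ^ n)) := by
          funext k
          simp only [hF]
          have : Complex.exp (I * ((j - k : ℤ) : ℂ) * p) =
              Complex.exp (-(I * p * k)) * Complex.exp (I * j * p) := by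
            rw [← Complex.exp_add]; congr 1; push_cast; ring
          rw [this]; ring
        have hval : (1 / (2 * π) * (Complex.exp (I * j * p) * symb δ₂ p ^ (n + 1)) : ℂ) =
            symb δ₂ p * (1 / (2 * π) * (Complex.exp (I * j * p) * symb δ₂ p ^ n)) := by
          rw [pow_succ]; ring
        rw [hfun, hval]; exact h
    rw [gn_succ, Complex.ofReal_tsum]
    simp_rw [Complex.ofReal_mul, ih]
    rw [show (∑' k : ℤ, (g1 δ₂ k : ℂ) * (1 / (2 * π) *
        ∫ p in (-π)..π, Complex.exp (I * ((j - k : ℤ) : ℂ) * p) * symb δ₂ p ^ n)) =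
        ∑' k : ℤ, ∫ p in (-π)..π, F k p from tsum_congr fun k => (hFint k).symm]
    rw [hDCT.tsum_eq, intervalIntegral.integral_const_mul]

/-- **Display (5.19) with the integrand written exactly as printed**, `(1 − e^{−2δ₂})ⁿ / ((1 − e^{−ip}e^{−δ₂})ⁿ
(1 − e^{ip}e^{−δ₂})ⁿ)`. [cite: Balaban1983RegularityDecay, (5.19) p.596] -/
theorem eq519_printed (hδ : 0 < δ₂) (n : ℕ) (j : ℤ) :
    ((gn δ₂ n j : ℝ) : ℂ) = 1 / (2 * π) * ∫ p in (-π)..π, Complex.exp (I * j * p) *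
      ((1 - Real.exp (-(2 * δ₂)) : ℂ) ^ n /
        ((1 - Complex.exp (-(I * p)) * Real.exp (-δ₂)) ^ n * (1 - Complex.exp (I * p) * Real.exp (-δ₂)) ^ n)) := by
  rw [eq519 hδ n j]
  congr 1
  refine intervalIntegral.integral_congr fun p _ => ?_
  simp only [symb, div_pow, mul_pow]

/-! ## §6 Display (5.20) from (5.19): the contour shift `Im p = ½δ₂` -/

/-- The integrand of (5.19) continued to complex momenta is `2π`-periodic.
[cite: Balaban1983RegularityDecay, (5.19) p.596] -/
theorem integrand_add_two_pi (δ₂ : ℝ) (n : ℕ) (j : ℤ) (z : ℂ) :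
    Complex.exp (I * j * (z + 2 * π)) * symb δ₂ (z + 2 * π) ^ n = Complex.exp (I * j * z) * symb δ₂ z ^ n := by
  rw [symb_add_two_pi]
  congr 1
  rw [show I * j * (z + 2 * π) = I * j * z + (j : ℂ) * (2 * π * I) by ring, Complex.exp_add,
    Complex.exp_int_mul_two_pi_mul_I, mul_one]

/-- **The contour shift.** For `0 ≤ a < δ₂` the integral of (5.19) may be taken over the line `Im p = a`:
`∫_{−π}^{π} e^{ijp}symb(p)ⁿ dp = ∫_{−π}^{π} e^{ij(p+ia)}symb(p+ia)ⁿ dp` (Cauchy's theorem on the rectangle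
`[−π, π] × [0, a]`, inside the strip of analyticity `|Im p| < δ₂`; the vertical sides cancel by `2π`-periodicity).
[cite: Balaban1983RegularityDecay, (5.20) p.596] -/
theorem integral_shift (hδ : 0 < δ₂) (n : ℕ) (j : ℤ) {a : ℝ} (ha0 : 0 ≤ a) (ha : a < δ₂) :
    ∫ p in (-π)..π, Complex.exp (I * j * p) * symb δ₂ p ^ n =
      ∫ p in (-π)..π, Complex.exp (I * j * (p + a * I)) * symb δ₂ (p + a * I) ^ n := by
  set h : ℂ → ℂ := fun z => Complex.exp (I * j * z) * symb δ₂ z ^ n with hh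
  have hper : ∀ z, h (z + 2 * π) = h z := fun z => by
    simp only [hh]; exact integrand_add_two_pi δ₂ n j z
  -- analyticity on the closed rectangle
  have hdiff : DifferentiableOn ℂ h ([[(-π : ℝ), π]] ×ℂ [[(0 : ℝ), a]]) := by
    intro z hz
    rw [mem_reProdIm, uIcc_of_le ha0] at hz
    have him : 0 ≤ z.im ∧ z.im ≤ a := ⟨hz.2.1, hz.2.2⟩
    have aux : ∀ u : ℂ, ‖u‖ < 1 → (1 : ℂ) - u ≠ 0 := fun u hu h0 => by
      rw [← (sub_eq_zero.mp h0), norm_one] at hu; exact lt_irrefl _ hu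
    have hne1 : (1 : ℂ) - Complex.exp (-(I * z)) * (Real.exp (-δ₂) : ℂ) ≠ 0 := by
      refine aux _ ?_
      rw [norm_factor_neg]; exact Real.exp_lt_one_iff.mpr (by linarith)
    have hne2 : (1 : ℂ) - Complex.exp (I * z) * (Real.exp (-δ₂) : ℂ) ≠ 0 := by
      refine aux _ ?_
      rw [norm_factor_pos]; exact Real.exp_lt_one_iff.mpr (by linarith)
    refine DifferentiableAt.differentiableWithinAt ?_
    simp only [hh, symb]
    refine DifferentiableAt.mul (by fun_prop) (DifferentiableAt.pow ?_ n)
    refine DifferentiableAt.div (by fun_prop) (by fun_prop) (mul_ne_zero hne1 hne2)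
  have hre1 : (((-π : ℝ)) : ℂ).re = -π := by simp
  have him1 : (((-π : ℝ)) : ℂ).im = 0 := by simp
  have hre2 : ((π : ℂ) + a * I).re = π := by simp
  have him2 : ((π : ℂ) + a * I).im = a := by simp
  have hrect := Complex.integral_boundary_rect_eq_zero_of_differentiableOn h ((-π : ℝ) : ℂ) (π + a * I)
    (by rw [hre1, him1, hre2, him2]; exact hdiff)
  rw [hre1, him1, hre2, him2] at hrect
  -- the vertical sides cancel by periodicity
  have hvert : (∫ y in (0 : ℝ)..a, h ((π : ℝ) + y * I)) = ∫ y in (0 : ℝ)..a, h ((-π : ℝ) + y * I) := by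
    refine intervalIntegral.integral_congr fun y _ => ?_
    have e : ((π : ℝ) : ℂ) + y * I = (((-π : ℝ) : ℂ) + y * I) + 2 * π := by push_cast; ring
    rw [e, hper]
  rw [hvert, add_sub_cancel_right] at hrect
  have h0 : (∫ x in (-π)..π, h (x + (0 : ℝ) * I)) = ∫ x in (-π)..π, h x :=
    intervalIntegral.integral_congr fun x _ => by simp
  rw [h0] at hrect
  have hA := sub_eq_zero.mp hrect
  simp only [hh] at hA
  exact hA

/-- **Display (5.20) from (5.19)** *"and from this we obtain |g_n(j)| ≤ c₂ⁿe^{−½δ₂|j|}, for some c₂"* — with the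
explicit `c₂ = (1 − e^{−2δ₂})/((1 − e^{−δ₂/2})(1 − e^{−3δ₂/2}))` (`c2`): by evenness take `j ≥ 0`, move the integral of
(5.19) to `Im p = ½δ₂` (`integral_shift`), where `|e^{ijp}| = e^{−½δ₂j}` and `|symb| ≤ c₂`.
[cite: Balaban1983RegularityDecay, (5.20) p.596] -/
theorem ineq520 (hδ : 0 < δ₂) (n : ℕ) (j : ℤ) :
    |gn δ₂ n j| ≤ c2 δ₂ ^ n * Real.exp (-(δ₂ / 2 * |(j : ℝ)|)) := by
  wlog hj : 0 ≤ j generalizing j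
  · have := this (-j) (by omega)
    rwa [gn_neg, Int.cast_neg, abs_neg] at this
  set a : ℝ := δ₂ / 2 with ha
  have ha0 : 0 ≤ a := by positivity
  have haδ : a < δ₂ := by rw [ha]; linarith
  have h519 := eq519 hδ n j
  rw [integral_shift hδ n j ha0 haδ] at h519
  -- the shifted integrand is bounded by `e^{−aj} c₂ⁿ`
  have hbd : ∀ x : ℝ, ‖Complex.exp (I * j * (x + a * I)) * symb δ₂ (x + a * I) ^ n‖ ≤
      Real.exp (-(a * j)) * c2 δ₂ ^ n := by
    intro x
    rw [norm_mul, norm_pow]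
    have he : ‖Complex.exp (I * j * (x + a * I))‖ = Real.exp (-(a * j)) := by
      rw [Complex.norm_exp]; congr 1; simp; ring
    rw [he]
    exact mul_le_mul_of_nonneg_left (pow_le_pow_left₀ (norm_nonneg _) (norm_symb_shift_le hδ x) n)
      (Real.exp_pos _).le
  have hI := intervalIntegral.norm_integral_le_of_norm_le_const (a := -π) (b := π)
    (fun x _ => hbd x)
  have habs : |gn δ₂ n j| = ‖((gn δ₂ n j : ℝ) : ℂ)‖ := by
    rw [Complex.norm_real, Real.norm_eq_abs]
  rw [habs, h519, norm_mul, norm_one_div_two_pi]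
  have h2π : |π - -π| = 2 * π := by
    rw [sub_neg_eq_add, ← two_mul, abs_of_pos (by positivity)]
  rw [h2π] at hI
  have hjabs : |(j : ℝ)| = j := abs_of_nonneg (by exact_mod_cast hj)
  calc 1 / (2 * π) * ‖∫ x in (-π)..π, Complex.exp (I * j * (x + a * I)) * symb δ₂ (x + a * I) ^ n‖
      ≤ 1 / (2 * π) * (Real.exp (-(a * j)) * c2 δ₂ ^ n * (2 * π)) :=
        mul_le_mul_of_nonneg_left hI (by positivity)
    _ = c2 δ₂ ^ n * Real.exp (-(δ₂ / 2 * |(j : ℝ)|)) := by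
        rw [hjabs, ha]
        field_simp

/-- **(5.20) verbatim** *"|g_n(j)| ≤ c₂ⁿe^{−½δ₂|j|}, for some c₂"* (for all `n` and `j`; `c₂` depends on `δ₂` only).
[cite: Balaban1983RegularityDecay, (5.20) p.596] -/
theorem ineq520_printed (hδ : 0 < δ₂) :
    ∃ c₂ : ℝ, ∀ n : ℕ, ∀ j : ℤ, |gn δ₂ n j| ≤ c₂ ^ n * Real.exp (-(δ₂ / 2 * |(j : ℝ)|)) :=
  ⟨c2 δ₂, ineq520 hδ⟩

/-! ## §7 *"the sum over j's factorizes into sums over components … Π_μ g_{2n}(j_μ − j′_μ)"* (p. 595) -/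

/-- `c₂ > 0`. [cite: Balaban1983RegularityDecay, (5.20) p.596] -/
theorem c2_pos (hδ : 0 < δ₂) : 0 < c2 δ₂ := by
  unfold c2
  have h1 : Real.exp (-(2 * δ₂)) < 1 := Real.exp_lt_one_iff.mpr (by linarith)
  have h2 : Real.exp (-(δ₂ / 2)) < 1 := Real.exp_lt_one_iff.mpr (by linarith)
  have h3 : Real.exp (-(3 * δ₂ / 2)) < 1 := Real.exp_lt_one_iff.mpr (by linarith)
  exact div_pos (by linarith) (mul_pos (by linarith) (by linarith))

/-- `g_n ≥ 0`. [cite: Balaban1983RegularityDecay, (5.19) p.596] -/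
theorem gn_nonneg (δ₂ : ℝ) (n : ℕ) (j : ℤ) : 0 ≤ gn δ₂ n j := by
  induction n generalizing j with
  | zero => simp only [gn_zero]; split_ifs <;> norm_num
  | succ n ih => exact tsum_nonneg fun k => mul_nonneg (g1_nonneg δ₂ k) (ih _)

/-- `g_n ≤ c₂ⁿ` (from (5.20)). [cite: Balaban1983RegularityDecay, (5.20) p.596] -/
theorem gn_le (hδ : 0 < δ₂) (n : ℕ) (j : ℤ) : gn δ₂ n j ≤ c2 δ₂ ^ n := by
  have h := ineq520 hδ n j
  have h1 : Real.exp (-(δ₂ / 2 * |(j : ℝ)|)) ≤ 1 :=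
    Real.exp_le_one_iff.mpr (by nlinarith [abs_nonneg (j : ℝ)])
  have hc : 0 ≤ c2 δ₂ ^ n := pow_nonneg (c2_pos hδ).le n
  calc gn δ₂ n j ≤ |gn δ₂ n j| := le_abs_self _
    _ ≤ c2 δ₂ ^ n * Real.exp (-(δ₂ / 2 * |(j : ℝ)|)) := h
    _ ≤ c2 δ₂ ^ n := mul_le_of_le_one_right hc h1

/-- The convolution step `g_{n+1}(x) = Σ_l g₁(l)g_n(x − l)` as a convergent (`HasSum`) series.
[cite: Balaban1983RegularityDecay, (5.19) p.595] -/
theorem hasSum_gn_succ (hδ : 0 < δ₂) (n : ℕ) (x : ℤ) :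
    HasSum (fun l : ℤ => g1 δ₂ l * gn δ₂ n (x - l)) (gn δ₂ (n + 1) x) := by
  have hs : Summable fun l : ℤ => g1 δ₂ l * gn δ₂ n (x - l) := by
    refine Summable.of_nonneg_of_le (fun l => mul_nonneg (g1_nonneg δ₂ l) (gn_nonneg δ₂ n _))
      (fun l => mul_le_mul_of_nonneg_left (gn_le hδ n _) (g1_nonneg δ₂ l)) ((summable_g1 hδ).mul_right _)
  rw [gn_succ]; exact hs.hasSum

/-- **`g_m = g₁ * … * g₁` unrolled** (one component): for `k ≥ 0` intermediate points `j₁, …, j_k ∈ Z` the chain sum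
`Σ_{j₁,…,j_k ∈ Z} g₁(j − j₁)g₁(j₁ − j₂)…g₁(j_k − j′)` converges (`HasSum` over `Z^k`) to `g_{k+1}(j − j′)` (the chain is
the tuple `(j, j₁, …, j_k, j′) = Fin.cons j (Fin.snoc J j′)`). [cite: Balaban1983RegularityDecay, (5.19) p.595] -/
theorem hasSum_chain (hδ : 0 < δ₂) (k : ℕ) (j j' : ℤ) :
    HasSum (fun J : Fin k → ℤ => ∏ i : Fin (k + 1),
        g1 δ₂ ((Fin.cons j (Fin.snoc J j') : Fin (k + 2) → ℤ) (Fin.castSucc i) -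
          (Fin.cons j (Fin.snoc J j') : Fin (k + 2) → ℤ) (Fin.succ i)))
      (gn δ₂ (k + 1) (j - j')) := by
  induction k generalizing j with
  | zero =>
    have hval : ∀ J : Fin 0 → ℤ, (∏ i : Fin (0 + 1),
        g1 δ₂ ((Fin.cons j (Fin.snoc J j') : Fin (0 + 2) → ℤ) (Fin.castSucc i) -
          (Fin.cons j (Fin.snoc J j') : Fin (0 + 2) → ℤ) (Fin.succ i))) = g1 δ₂ (j - j') := by
      intro J
      rw [Fin.prod_univ_one]
      congr 1
    have h1 : gn δ₂ (0 + 1) (j - j') = g1 δ₂ (j - j') := gn_one δ₂ _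
    simp_rw [hval, h1]
    have h2 := hasSum_fintype (fun _ : Fin 0 → ℤ => g1 δ₂ (j - j'))
    simp only [Finset.univ_unique, Finset.sum_const, Finset.card_singleton, one_smul] at h2
    exact h2
  | succ k ih =>
    rw [← (Fin.consEquiv fun _ : Fin (k + 1) => ℤ).hasSum_iff]
    -- the term at `J = Fin.cons j₁ J'` splits off the first factor `g₁(j − j₁)`
    set T : ℤ → (Fin k → ℤ) → ℝ := fun j₁ J' => ∏ i : Fin (k + 1),
        g1 δ₂ ((Fin.cons j₁ (Fin.snoc J' j') : Fin (k + 2) → ℤ) (Fin.castSucc i) -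
          (Fin.cons j₁ (Fin.snoc J' j') : Fin (k + 2) → ℤ) (Fin.succ i)) with hT
    have hterm : ((fun J : Fin (k + 1) → ℤ => ∏ i : Fin (k + 1 + 1),
        g1 δ₂ ((Fin.cons j (Fin.snoc J j') : Fin (k + 1 + 2) → ℤ) (Fin.castSucc i) -
          (Fin.cons j (Fin.snoc J j') : Fin (k + 1 + 2) → ℤ) (Fin.succ i))) ∘
          (Fin.consEquiv fun _ : Fin (k + 1) => ℤ)) =
        fun p : ℤ × (Fin k → ℤ) => g1 δ₂ (j - p.1) * T p.1 p.2 := by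
      have hce : ∀ p : ℤ × (Fin k → ℤ), (Fin.consEquiv fun _ : Fin (k + 1) => ℤ) p = Fin.cons p.1 p.2 :=
        fun p => rfl
      funext p
      rcases p with ⟨j₁, J'⟩
      simp only [Function.comp_apply, hce, hT]
      rw [← Fin.cons_snoc_eq_snoc_cons, Fin.prod_univ_succ]
      rfl
    rw [hterm]
    -- fibers (IH at `j₁`) and the outer convolution sum
    have hfib : ∀ j₁ : ℤ, HasSum (fun J' : Fin k → ℤ => g1 δ₂ (j - j₁) * T j₁ J')
        (g1 δ₂ (j - j₁) * gn δ₂ (k + 1) (j₁ - j')) := fun j₁ => (ih j₁).mul_left _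
    have hout : HasSum (fun j₁ : ℤ => g1 δ₂ (j - j₁) * gn δ₂ (k + 1) (j₁ - j'))
        (gn δ₂ (k + 1 + 1) (j - j')) := by
      have h := (Equiv.subLeft j).hasSum_iff.mpr (hasSum_gn_succ hδ (k + 1) (j - j'))
      convert h using 2 with j₁
      simp only [Function.comp_apply, Equiv.subLeft_apply]
      congr 2; ring
    have hnn : 0 ≤ fun p : ℤ × (Fin k → ℤ) => g1 δ₂ (j - p.1) * T p.1 p.2 := fun p =>
      mul_nonneg (g1_nonneg δ₂ _) (Finset.prod_nonneg fun i _ => g1_nonneg δ₂ _)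
    have hsum : Summable fun p : ℤ × (Fin k → ℤ) => g1 δ₂ (j - p.1) * T p.1 p.2 :=
      (summable_prod_of_nonneg hnn).mpr
        ⟨fun j₁ => (hfib j₁).summable, hout.summable.congr fun j₁ => ((hfib j₁).tsum_eq).symm⟩
    have hval : ∑' p : ℤ × (Fin k → ℤ), g1 δ₂ (j - p.1) * T p.1 p.2 = gn δ₂ (k + 1 + 1) (j - j') :=
      (hsum.hasSum.prod_fiberwise hfib).unique hout
    exact hval ▸ hsum.hasSum

/-- **Tonelli on `X^ι` for products of non-negative coordinate factors** (`ι` finite, `X` arbitrary): if `f_i ≥ 0`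
has sum `a_i` on `X`, then `Σ_{m ∈ X^ι} Π_i f_i(m_i) = Π_i a_i` (`HasSum`) — *"the sum over j's factorizes into sums
over components"*. [cite: Balaban1983RegularityDecay, (5.19) p.595] -/
theorem hasSum_pi_prod_of_nonneg : ∀ (n : ℕ) {X : Type*} (f : Fin n → X → ℝ) (_hf : ∀ i x, 0 ≤ f i x)
    (a : Fin n → ℝ) (_h : ∀ i, HasSum (f i) (a i)),
    HasSum (fun m : Fin n → X => ∏ i, f i (m i)) (∏ i, a i)
  | 0, X, f, hf, a, h => by
    have h1 : (fun m : Fin 0 → X => ∏ i, f i (m i)) = fun _ => 1 := by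
      funext m; simp
    rw [h1, Finset.univ_eq_empty, Finset.prod_empty]
    have h2 := hasSum_fintype (fun _ : Fin 0 → X => (1 : ℝ))
    simp only [Finset.univ_unique, Finset.sum_const, Finset.card_singleton, one_smul] at h2
    exact h2
  | n + 1, X, f, hf, a, h => by
    have ih := hasSum_pi_prod_of_nonneg n (fun i : Fin n => f i.succ) (fun i x => hf _ _)
      (fun i => a i.succ) (fun i => h i.succ)
    have h0 := h 0
    have hn0 : Summable fun x => ‖f 0 x‖ :=
      h0.summable.abs.congr fun x => (Real.norm_eq_abs _).symm
    set g : (Fin n → X) → ℝ := fun m => ∏ i : Fin n, f i.succ (m i) with hg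
    have ih' : HasSum g (∏ i : Fin n, a i.succ) := ih
    have hn1 : Summable fun m : Fin n → X => ‖g m‖ :=
      ih'.summable.abs.congr fun m => (Real.norm_eq_abs _).symm
    have hmul : HasSum (fun p : X × (Fin n → X) => f 0 p.1 * g p.2) (a 0 * ∏ i : Fin n, a i.succ) :=
      HasSum.mul (f := f 0) (g := g) h0 ih' (summable_mul_of_summable_norm (f := f 0) (g := g) hn0 hn1)
    rw [Fin.prod_univ_succ]
    refine ((Fin.consEquiv (fun _ : Fin (n + 1) => X)).hasSum_iff).1 ?_
    have hce : ∀ p : X × (Fin n → X), (Fin.consEquiv fun _ : Fin (n + 1) => X) p = Fin.cons p.1 p.2 :=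
      fun p => rfl
    convert hmul using 1
    funext p
    simp only [Function.comp_apply, hce, hg]
    rw [Fin.prod_univ_succ]
    simp only [Fin.cons_zero, Fin.cons_succ]

/-- *"|j| = Σ_{μ=1}^{d}|j_μ| … the sum over j's factorizes"*: the weight `e^{−δ₂|x|}` of `Z^d` with the `ℓ¹`
absolute value is the product of the one-dimensional weights, `e^{−δ₂Σ_μ|x_μ|} = Π_μ g₁(x_μ)`.
[cite: Balaban1983RegularityDecay, (5.19) p.595] -/
theorem exp_neg_l1_eq_prod (δ₂ : ℝ) {d : ℕ} (x : Fin d → ℤ) :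
    Real.exp (-(δ₂ * ∑ μ, |(x μ : ℝ)|)) = ∏ μ, g1 δ₂ (x μ) := by
  simp only [g1]
  rw [← Real.exp_sum, Finset.mul_sum, ← Finset.sum_neg_distrib]

/-- **The sentence of p. 595** *"the sum over j's in (5.18) can be written as Π_{μ=1}^{d} g_{2n}(j_μ − j′_μ),
g_{2n} = g₁ * … * g₁"*, typed for a chain of any number `k + 1 ≥ 1` of steps (the print's `2n`): with
`|x| = Σ_μ|x_μ|` on `Z^d`, the sum over the intermediate points `j₁, …, j_k ∈ Z^d` of
`e^{−δ₂|j−j₁|}e^{−δ₂|j₁−j₂|}…e^{−δ₂|j_k−j′|}` converges (`HasSum` over `(Z^d)^k`) to `Π_μ g_{k+1}(j_μ − j′_μ)`.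
[cite: Balaban1983RegularityDecay, (5.19) p.595] -/
theorem hasSum_chain_factorizes (hδ : 0 < δ₂) {d : ℕ} (k : ℕ) (j j' : Fin d → ℤ) :
    HasSum (fun J : Fin k → (Fin d → ℤ) => ∏ i : Fin (k + 1),
        Real.exp (-(δ₂ * ∑ μ, |(((Fin.cons j (Fin.snoc J j') : Fin (k + 2) → (Fin d → ℤ)) (Fin.castSucc i) μ -
          (Fin.cons j (Fin.snoc J j') : Fin (k + 2) → (Fin d → ℤ)) (Fin.succ i) μ : ℤ) : ℝ)|)))
      (∏ μ, gn δ₂ (k + 1) (j μ - j' μ)) := by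
  -- the one-dimensional chain term of coordinate `μ`
  set Φ : Fin d → (Fin k → ℤ) → ℝ := fun μ K => ∏ i : Fin (k + 1),
      g1 δ₂ ((Fin.cons (j μ) (Fin.snoc K (j' μ)) : Fin (k + 2) → ℤ) (Fin.castSucc i) -
        (Fin.cons (j μ) (Fin.snoc K (j' μ)) : Fin (k + 2) → ℤ) (Fin.succ i)) with hΦ
  have hΦnn : ∀ μ K, 0 ≤ Φ μ K := fun μ K => Finset.prod_nonneg fun i _ => g1_nonneg δ₂ _
  have hΦsum : ∀ μ, HasSum (Φ μ) (gn δ₂ (k + 1) (j μ - j' μ)) := fun μ => hasSum_chain hδ k (j μ) (j' μ)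
  -- Tonelli over the components, for the transposed variable `K : Fin d → (Fin k → ℤ)`
  have hT := hasSum_pi_prod_of_nonneg d Φ hΦnn _ hΦsum
  -- transpose `J i μ ↔ K μ i`
  rw [← (Equiv.piComm fun (_ : Fin d) (_ : Fin k) => ℤ).hasSum_iff] 
  convert hT using 1
  funext K
  simp only [Function.comp_apply, hΦ]
  -- each step weight factorizes over `μ`; then exchange the two finite products
  have hcoord : ∀ (i : Fin (k + 2)) (μ : Fin d),
      (Fin.cons j (Fin.snoc ((Equiv.piComm fun (_ : Fin d) (_ : Fin k) => ℤ) K) j') : Fin (k + 2) → (Fin d → ℤ)) i μ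
        = (Fin.cons (j μ) (Fin.snoc (K μ) (j' μ)) : Fin (k + 2) → ℤ) i := by
    intro i μ
    have e1 : (fun x : Fin d → ℤ => x μ) ∘ (Fin.cons j (Fin.snoc ((Equiv.piComm fun (_ : Fin d) (_ : Fin k) => ℤ) K) j')
        : Fin (k + 2) → (Fin d → ℤ)) = (Fin.cons (j μ) (Fin.snoc (K μ) (j' μ)) : Fin (k + 2) → ℤ) := by
      rw [Fin.comp_cons, Fin.comp_snoc]
      rfl
    exact congrFun e1 i
  simp_rw [exp_neg_l1_eq_prod, hcoord]
  rw [Finset.prod_comm]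

end Literature.MathematicalPhysics.QuantumFieldTheory.Balaban1983to89.B4Sect5Fourier519

end
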